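import Literature.MathematicalPhysics.QuantumFieldTheory.Balaban1983to89.B9Eq386GreenkLipschitzEnergyDiagonal
import Literature.MathematicalPhysics.QuantumFieldTheory.Balaban1983to89.B9Thm311SmallFieldCoercivityTowerClosed

/-!
# `Balaban1983to89.B9Eq386GreenLipschitzEnergyClosed` — T. Bałaban, *Propagators for lattice gauge theories in a background field*, Commun. Math. Phys.
# **99** (1985) 389–434 [Balaban1985BackgroundPropagators] Thm 3.4 p. 400 ∕ (3.84)–(3.86) p. 407 with (3.25) p. 394 and Thm 3.11 p. 416 AT `k = n+1` AVERAGING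
# LEVELS ON PRINT's DIAGONAL `ηL^{n+1} = 1`: **THE `k`-TH-STEP GREEN's FUNCTION IS LIPSCHITZ IN THE BACKGROUND AT THE FLAT POINT IN THE ENERGY NORM WITH
# NO DISPLAYED OPERATOR LETTER — the row OWNER's `B9Eq386GreenkLipschitzEnergyDiagonal.exists_norm_G1k_sub_flat_le_diagonal_closed` with its last displayed
# letter, the `R`-letter `‖R_k(U)y − R_k(1)y‖ ≤ C_R·α·‖y‖`, INHABITED by `B9Eq325RLipschitzSqrtTowerLinear.norm_RofUk_sub_RofUk_one_le_diagonal_linear`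
# (`C_R := 3S̄∕s♯`, closed in `(d, L, M_φM_φ′, r)`)**

statement-level skeleton of published theorems with citation tags; proofs where landed; nothing here is a claim about the Yang–Mills mass gap

CITATION HEADER (lean-in-tree rule).  Audit cell `pub-balaban`, sub-cell `t4`, BINDER row NE9 (node U3 `NE9PropagatorRegularity`, (k)-indexed reading
«for all k … ≤ C e^{−δ dist}» — NOT PRINTED ∕ NOT PROVED); filed by the NE9 crux-team LEAF PROVER 04 lineage `b2b-balaban-t4-ne9-formalise-leaf-04` (gen 76)
on the row OWNER's OFFER (t4-ne9-p1 g86 W-2 ∕ STAGED-4: «the closing corollary TAKEN = YOURS»).  Sources READ first-hand by this lineage in the held text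
layer [Balaban1985BackgroundPropagators] (`paper:balaban1985-cmp99-background-propagators`, journal page = PDF page + 388) pp. 394 ((3.24)–(3.25)), 396
((3.35)–(3.37)), 400 (Thms 3.3∕3.4), 403, 407 ((3.82)–(3.86)), 416 (Thm 3.11).

THE PRINT (verbatim, text layer).  p. 400, Thm 3.4: *«There exists a positive constant α₁ such that the operators G′(U), (Q′(U)G′²(U)Q′*(U))⁻¹, R(U), G(U)
extend to configurations U′U for α ≤ α₁ as analytic functions of A. The extended operators satisfy all the inequalities of Theorems 3.1–3.3 correspondingly.
In fact we prove quantitative statements which are more precise, describing these analytic extensions as small perturbations of the operators depending on U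
only.»*; p. 407, (3.86): *«G(U′U) = G(U)(I − V(A)G(U))⁻¹»*; p. 394, (3.25): *«R(U) = Δ(U)G′(U)Q′*(U)(Q′(U)G′²(U)Q′*(U))⁻¹Q′(U)G′(U)Δ(U)»*; p. 416, Thm 3.11:
*«Under the assumptions of the Theorems 3.1–3.10 (i.e. for M sufficiently large and α₀ sufficiently small) the operators Δ′_a, G′, (Q′G′²Q′*)⁻¹, Δ_a, G are
positive definite.»*

WHY THIS FILE (cell context).  The OWNER's `B9Eq386GreenkLipschitzEnergyDiagonal` (g86) proves, on print's diagonal and in the energy currency,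
`‖G_k(U)y − G_k(1)y‖, ‖curl₁(…)‖, ‖div₁(…)‖ ≤ C·α·‖y‖` with `∃ α₀ C` BEFORE every lattice ∕ height ∕ weight ∕ volume ∕ background binder, `C` closed in
`(d, a, L, M_φ, M_φ′, r, C_τ, ρ_w, C_R)` — MODULO ONE displayed operator letter, the `R`-letter `hR : ‖R_k(U)s − R_k(1)s‖ ≤ C_R·α·‖s‖` of print's (3.25)
representation.  This lineage's `B9Eq325RLipschitzSqrtTowerLinear.norm_RofUk_sub_RofUk_one_le_diagonal_linear` (g75) IS the literal inhabitant of that slot: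
under the SAME windows (`U(b) ∈ U1`, `‖U(b) − 1‖ ≤ αη`, `hRS`, `‖Ū^j(b) − 1‖ ≤ ε_j ≤ αr^j`) it gives `‖R_k(U)f − R_k(1)f‖ ≤ (3s_A∕s♯)·α·‖f‖` with the slopes
`s_A`, `s♯` closed in `(d, a′ = 1, M_φM_φ′, L, r, α₀)` once `α₀` is below two explicit windows.  THIS FILE closes the letter exactly as the OWNER's
`B9Thm311SmallFieldCoercivityTowerClosed` (g85) closed it for (SC-k): instantiate the OWNER's `∃` at the FIXED constant `C̄_R := 3S̄∕s♯`
(`S̄ = 2(48s_D + 192s_Q) + 4s_Q ≥ s_A` once `γ_m ≥ 1∕8`, `θ̄ ≤ 1` — the two private letters below, copied from the OWNER's g85 file where they are private),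
shrink `α₀` by the two windows of the `R`-letter and `s♯∕(2S̄ + 1)`, and discharge `hR` BY NAME (`3s_A∕s♯ ≤ C̄_R`).  No monotonicity of `C` in `C_R` is needed
(the `∃` is opened once, at `C̄_R`).  Result: the Green's-function Lipschitz letter of the chart (`Support/NE9CurChartLipschitzAtFlat`'s shape, first order at the
flat point) with NO displayed operator letter at all — the remaining hypotheses are E162's per-level data, `hRS`, the small-field WINDOWS, `C_τ`, `ρ_w` and the two
positivity witnesses (theorems on the diagonal: `B9Thm311LaplaceAkPositiveDiagonal`).

WHAT IS PROVED (sorry-free; 0 `def`; [folklore] composition BY NAME + threshold arithmetic; nothing of [B9] asserted as printed).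
* §1 (private) `gamma_m_ge`, `sA_le_bar` — the two arithmetic letters of `B9Thm311SmallFieldCoercivityTowerClosed` §1 (private there; copied verbatim).
* §2 **`exists_norm_G1k_sub_flat_le_diagonal_letterfree`** — the OWNER's statement WITH THE `C_R`∕`hR` BINDERS REMOVED: `∃ α₀ C > 0` (closed in
  `(d, a, L, M_φ, M_φ′, r, C_τ, ρ_w)`) such that for every `n`, `η` (`ηL^{n+1} = 1`), `c₀, c₁` (`c₀(L^{n+1})^d = c₁`, `|η|^d∕c₀ ≤ ρ_w`), `m`, background `U` of
  E162's data, `hRS`, the windows `‖U(b) − 1‖ ≤ αη`, `‖U(∂p) − 1‖ ≤ αη²`, `‖Ū^j(b) − 1‖ ≤ ε_j ≤ αr^j`, `0 ≤ α ≤ α₀`, ANY positivity witnesses of `Δ^{(n+1)}_a(U)` and of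
  the flat `Δ^{(n+1)}_a(1)`, and every `y`: `‖G_k(U)y − G_k(1)y‖ ≤ Cα‖y‖ ∧ ‖curl₁(G_k(U)y − G_k(1)y)‖ ≤ Cα‖y‖ ∧ ‖div₁(G_k(U)y − G_k(1)y)‖ ≤ Cα‖y‖`.
MODEL ∕ HONEST SCOPE.  Exactly the OWNER's (M1)–(M3): FIRST order at the flat point on the diagonal `ηL^{n+1} = 1` ONLY (not two general backgrounds, not
analyticity, not (3.86)'s series); the `L²`∕energy clause of Thm 3.4 — no kernel bound, no decay, NOT the (N)-reading; the small-field WINDOWS, `hRS`, `C_τ`,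
`ρ_w` and the two positivity witnesses stay HYPOTHESES; crude constants (`C̄_R` is print's «O(1) depending on d and L only» with no attempt at sharpness).
NOT summit progress (cell pub-balaban: NE9 NOT PRINTED ∕ NOT PROVED; «NE9 ⇐ the named binders»; row WALLED ON A MODEL (O-NE9-1; NEEDS-COORDINATOR #5 UNRULED);
spine PROVED 0∕9; rung (B)+1 finite T⁴ — NOT infinite volume, NOT mass gap, NOT BetaPertH, NOT Clay).  HONEST DEPENDENCY (cell line): continuum YM on T⁴ ⇐
BetaPertH ∧ nine spine estimates (0/9 proved); BetaPertH ⇐ (D1) ∧ (D4) ∧ CAP+tail; G-an2-4 gates asym, D1 and NE2/3/4.  NEW file importing the OWNER's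
`B9Eq386GreenkLipschitzEnergyDiagonal` and `B9Thm311SmallFieldCoercivityTowerClosed` (for `hLb_of_hU1` and, transitively, this lineage's
`B9Eq325RLipschitzSqrtTowerLinear`); nothing modified.  Net new unproved facts: 0.
-/

noncomputable section

open scoped InnerProductSpace ComplexConjugate BigOperators

namespace Literature.MathematicalPhysics.QuantumFieldTheory.Balaban1983to89.B9Eq386GreenLipschitzEnergyClosed

open B4Sect5Torus (TSite)
open B9SectCLatticeCarrier (Bond)
open B11Eq103H1Complex (SiteL2K BondL2K covDivL2K)
open B9Eq310HessianOperator (adTransportW covCurlL2K)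
open B9Eq310DeltaPrime (plaqHolU)
open B9Eq315QTorus (perCfg cornerSite)
open B9Eq315QTower (towerP UlevOf)
open B9Eq315QTowerFlat (perCfg_UlevOf_one_mem_U1 norm_Wcx_UlevOf_one_sub_one_le)
open B9Eq326OperatorTower (laplaceAk RofUk)
open B7Prop1Explicit (U1 Wcx boxVec)
open B9Eq386GreenkLipschitzEnergyDiagonal (exists_norm_G1k_sub_flat_le_diagonal_closed)
open B9Thm311SmallFieldCoercivityTowerClosed (hLb_of_hU1)
open B9Eq325RLipschitzSqrtTowerLinear (norm_RofUk_sub_RofUk_one_le_diagonal_linear)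

/-! ## §1 Two arithmetic letters (the OWNER's `B9Thm311SmallFieldCoercivityTowerClosed` §1, private there) -/

/-- The auxiliary site coercivity at the threshold stays above `1∕8` (at `a′ = 1`: `γ_f = 1∕4`) when `s_Dα₀ ≤ 1`, `s_Qα₀ ≤ 1` and
`2s_Dα₀ + 3s_Qα₀ ≤ 1∕8`. [folklore] -/
private theorem gamma_m_ge {sD sQ α₀ θb γm : ℝ} (hsD : 0 ≤ sD) (hsQ : 0 ≤ sQ) (hα : 0 ≤ α₀)
    (h3 : 2 * (sD * α₀) + 3 * (sQ * α₀) ≤ 1 / 8) (hθb : θb = sQ * α₀)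
    (hγm : γm = 1 / (2 + 2 / (1 : ℝ)) - (sD * α₀ + (sD * α₀) ^ 2 + (1 : ℝ) * θb * (2 * 1 + θb))) : 1 / 8 ≤ γm := by
  have pD : 0 ≤ sD * α₀ := mul_nonneg hsD hα
  have pQ : 0 ≤ sQ * α₀ := mul_nonneg hsQ hα
  have h1 : sD * α₀ ≤ 1 := by linarith
  have e1 : (sD * α₀) ^ 2 ≤ sD * α₀ := by
    rw [sq]; exact (mul_le_mul_of_nonneg_left h1 pD).trans (by rw [mul_one])
  have e2 : (1 : ℝ) * θb * (2 * 1 + θb) ≤ 3 * (sQ * α₀) := by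
    rw [one_mul, hθb]
    have : 2 * 1 + sQ * α₀ ≤ 3 := by linarith
    calc sQ * α₀ * (2 * 1 + sQ * α₀) ≤ sQ * α₀ * 3 := mul_le_mul_of_nonneg_left this pQ
      _ = 3 * (sQ * α₀) := by ring
  have hq : (1 : ℝ) / (2 + 2 / 1) = 1 / 4 := by norm_num
  rw [hγm, hq]
  linarith

/-- The slope letter `s_A` at the threshold is below `S̄ = 2(48s_D + 192s_Q) + 4s_Q` once `γ_m ≥ 1∕8` and `θ̄ ≤ 1`. [folklore] -/
private theorem sA_le_bar {sD sQ θb γm sG sA : ℝ} (hsD : 0 ≤ sD) (hsQ : 0 ≤ sQ) (hθb0 : 0 ≤ θb) (hθb1 : θb ≤ 1) (hγm : 1 / 8 ≤ γm)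
    (hsG : sG = 2 * sD * (γm⁻¹ * (Real.sqrt γm)⁻¹) + (|(1 : ℝ)| * sQ * ((1 + θb) + 1)) * γm⁻¹ ^ 2)
    (hsA : sA = sG * (1 + θb) + (2 + 2 / (1 : ℝ)) * sQ) : sA ≤ 2 * (48 * sD + 192 * sQ) + 4 * sQ := by
  have hγm0 : 0 < γm := lt_of_lt_of_le (by norm_num) hγm
  have hγinv : γm⁻¹ ≤ 8 := by rw [inv_le_comm₀ hγm0 (by norm_num)]; linarith
  have hγsqrt : (Real.sqrt γm)⁻¹ ≤ 3 := by
    have hs : Real.sqrt (1 / 8) ≤ Real.sqrt γm := Real.sqrt_le_sqrt hγm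
    have h18 : (1 : ℝ) / 3 ≤ Real.sqrt (1 / 8) := by
      rw [show (1 : ℝ) / 3 = Real.sqrt ((1 / 3) ^ 2) by rw [Real.sqrt_sq (by norm_num)]]
      exact Real.sqrt_le_sqrt (by norm_num)
    have hpos : 0 < Real.sqrt γm := Real.sqrt_pos.2 hγm0
    rw [inv_le_comm₀ hpos (by norm_num)]
    linarith
  have hγinv0 : 0 ≤ γm⁻¹ := by positivity
  have hγsqrt0 : 0 ≤ (Real.sqrt γm)⁻¹ := by positivity
  have hsGle : sG ≤ 48 * sD + 192 * sQ := by
    rw [hsG, abs_one, one_mul]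
    have h1 : γm⁻¹ * (Real.sqrt γm)⁻¹ ≤ 8 * 3 := mul_le_mul hγinv hγsqrt hγsqrt0 (by norm_num)
    have h2 : γm⁻¹ ^ 2 ≤ 8 ^ 2 := pow_le_pow_left₀ hγinv0 hγinv 2
    have h3 : (1 + θb) + 1 ≤ 3 := by linarith
    have h4 : 2 * sD * (γm⁻¹ * (Real.sqrt γm)⁻¹) ≤ 2 * sD * (8 * 3) := mul_le_mul_of_nonneg_left h1 (by positivity)
    have h5 : sQ * ((1 + θb) + 1) * γm⁻¹ ^ 2 ≤ sQ * 3 * 8 ^ 2 :=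
      mul_le_mul (mul_le_mul_of_nonneg_left h3 hsQ) h2 (by positivity) (by positivity)
    linarith
  have hsG0 : 0 ≤ sG := by rw [hsG]; positivity
  have h1 : sG * (1 + θb) ≤ (48 * sD + 192 * sQ) * 2 := mul_le_mul hsGle (by linarith) (by positivity) (by positivity)
  have hq : (2 : ℝ) + 2 / 1 = 4 := by norm_num
  rw [hsA, hq]
  linarith

/-! ## §2 The `k`-th-step Green's function Lipschitz at the flat point, energy norm, on the diagonal — no displayed operator letter -/

section Exists

variable {d : ℕ} (L : ℕ) [NeZero L] (hL : 1 ≤ L)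
  {𝔸 : Type*} [NormedRing 𝔸] [NormedAlgebra ℂ 𝔸] [CompleteSpace 𝔸] [NormOneClass 𝔸] [StarRing 𝔸] [NormedStarGroup 𝔸] [StarModule ℂ 𝔸]
  {W : Type*} [NormedAddCommGroup W] [InnerProductSpace ℂ W] [FiniteDimensional ℂ W] (φ : W ≃ₗ[ℂ] 𝔸)
  {Mφ Mφ' : ℝ} (hMφ : 0 ≤ Mφ) (hMφ' : 0 ≤ Mφ') (hφ : ∀ w, ‖φ w‖ ≤ Mφ * ‖w‖) (hφ' : ∀ X, ‖φ.symm X‖ ≤ Mφ' * ‖X‖)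
  {a : ℝ} (ha : 0 < a) {r : ℝ} (hr0 : 0 ≤ r) (hr1 : r < 1)
  (τ : 𝔸 →ₗ[ℂ] ℂ) {Cτ : ℝ} (hτ : ∀ X, ‖τ X‖ ≤ Cτ * ‖X‖) (hCτ : 0 ≤ Cτ) {ρw : ℝ} (hρw : 0 ≤ ρw)

include hMφ hMφ' hφ hφ' ha hr0 hr1 hτ hCτ hρw

/-- **THE `k`-TH-STEP GREEN's FUNCTION IS LIPSCHITZ IN THE BACKGROUND AT THE FLAT POINT IN THE ENERGY NORM, LEVEL-FREE ON THE DIAGONAL, WITH NO DISPLAYED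
OPERATOR LETTER**: there are `α₀, C > 0` (closed in `(d, a, L, M_φ, M_φ′, r, C_τ, ρ_w)`) such that for every `n`, `η` (`ηL^{n+1} = 1`), `c₀, c₁`
(`c₀(L^{n+1})^d = c₁`, `|η|^d∕c₀ ≤ ρ_w`), `m`, background `U` of E162's data with `hRS`, the windows `‖U(b) − 1‖ ≤ αη`, `‖U(∂p) − 1‖ ≤ αη²`,
`‖Ū^j(b) − 1‖ ≤ ε_j ≤ αr^j`, `0 ≤ α ≤ α₀`, ANY positivity witnesses of `Δ^{(n+1)}_a(U)` and of the flat `Δ^{(n+1)}_a(1)`, and every `y`: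
`‖G_k(U)y − G_k(1)y‖ ≤ Cα‖y‖`, `‖curl₁(G_k(U)y − G_k(1)y)‖ ≤ Cα‖y‖`, `‖div₁(G_k(U)y − G_k(1)y)‖ ≤ Cα‖y‖` — the OWNER's
`exists_norm_G1k_sub_flat_le_diagonal_closed` at `C_R := 3S̄∕s♯` with its `R`-letter `hR` DISCHARGED by
`B9Eq325RLipschitzSqrtTowerLinear.norm_RofUk_sub_RofUk_one_le_diagonal_linear` (auxiliary site penalty `a′ = 1`, slopes at `α₀`).
[cite: Balaban1985BackgroundPropagators, Thm 3.4 p.400, (3.84)–(3.86) p.407, (3.25) p.394, (3.35)–(3.37) p.396, p.403, Thm 3.11 p.416] -/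
theorem exists_norm_G1k_sub_flat_le_diagonal_letterfree :
    ∃ α₀ C : ℝ, 0 < α₀ ∧ 0 < C ∧ ∀ (n : ℕ) (η : ℝ), η * (L : ℝ) ^ (n + 1) = 1 →
      ∀ (c₀ c₁ : ℝ) [Fact (0 < c₀)] [Fact (0 < c₁)], c₀ * ((L : ℝ) ^ (n + 1)) ^ d = c₁ → |η| ^ d / c₀ ≤ ρw →
      ∀ (m : Fin d → ℕ) [∀ i, NeZero (m i)] (U : Bond d (towerP L m (n + 1)) → 𝔸ˣ) (αU : ℕ → ℝ) (hα1 : ∀ j, αU j ≤ 1 / 64)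
        (hU1 : ∀ (j : ℕ) (x : B7Prop1Explicit.Site d) (κ : Fin d), perCfg (towerP L m (j + 1)) (UlevOf L m (n + 1) U j) x κ ∈ U1 𝔸)
        (hreg : ∀ (j : ℕ) (y : TSite d (towerP L m j)) (κ : Fin d) (r : Fin d → Fin L),
          ‖((Wcx L (perCfg (towerP L m (j + 1)) (UlevOf L m (n + 1) U j)) (cornerSite L y) κ (boxVec L r) : 𝔸ˣ) : 𝔸) - 1‖ ≤ αU j)
        (εU : ℕ → ℝ), (∀ j, 0 ≤ εU j) → (∀ (j : ℕ) (b : Bond d (towerP L m (j + 1))), ‖(UlevOf L m (n + 1) U j b : 𝔸) - 1‖ ≤ εU j) →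
      ∀ {α : ℝ}, 0 ≤ α → α ≤ α₀ →
        (∀ (b : Bond d (towerP L m (n + 1))) (v u : W), ⟪adTransportW φ U b v, u⟫_ℂ = ⟪v, adTransportW φ (fun b => (U b)⁻¹) b u⟫_ℂ) →
        (∀ b, U b ∈ U1 𝔸) → (∀ b, ‖(U b : 𝔸) - 1‖ ≤ α * η) →
        (∀ p : B9SectCLatticeCarrier.Plaq d (towerP L m (n + 1)), ‖(plaqHolU U p : 𝔸) - 1‖ ≤ α * η ^ 2) →
        (∀ j < n + 1, εU j ≤ α * r ^ j) →
        ∀ (hposU : ∀ x : BondL2K ℂ d (towerP L m (n + 1)) c₀ W, x ≠ 0 →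
            0 < RCLike.re ⟪x, laplaceAk L m n φ η U hL αU hα1 hU1 hreg τ (c₀ := c₀) (c₁ := c₁) a x⟫_ℂ)
          (hpos1 : ∀ x : BondL2K ℂ d (towerP L m (n + 1)) c₀ W, x ≠ 0 →
            0 < RCLike.re ⟪x, laplaceAk L m n φ η (fun _ : Bond d (towerP L m (n + 1)) => (1 : 𝔸ˣ)) hL (fun _ => 0) (fun _ => by norm_num)
              (perCfg_UlevOf_one_mem_U1 L m (n + 1)) (norm_Wcx_UlevOf_one_sub_one_le L m (n + 1) (fun _ => 0) (fun _ => le_rfl)) τ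
              (c₀ := c₀) (c₁ := c₁) a x⟫_ℂ)
          (y : BondL2K ℂ d (towerP L m (n + 1)) c₀ W),
          ‖B11Eq103H1Complex.greenK (laplaceAk L m n φ η U hL αU hα1 hU1 hreg τ (c₀ := c₀) (c₁ := c₁) a) hposU y -
            B11Eq103H1Complex.greenK (laplaceAk L m n φ η (fun _ : Bond d (towerP L m (n + 1)) => (1 : 𝔸ˣ)) hL (fun _ => 0) (fun _ => by norm_num)
              (perCfg_UlevOf_one_mem_U1 L m (n + 1)) (norm_Wcx_UlevOf_one_sub_one_le L m (n + 1) (fun _ => 0) (fun _ => le_rfl)) τ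
              (c₀ := c₀) (c₁ := c₁) a) hpos1 y‖ ≤ C * α * ‖y‖ ∧
          ‖covCurlL2K ℂ c₀ ((η : ℂ))⁻¹ (adTransportW φ (fun _ : Bond d (towerP L m (n + 1)) => (1 : 𝔸ˣ)))
            (B11Eq103H1Complex.greenK (laplaceAk L m n φ η U hL αU hα1 hU1 hreg τ (c₀ := c₀) (c₁ := c₁) a) hposU y -
            B11Eq103H1Complex.greenK (laplaceAk L m n φ η (fun _ : Bond d (towerP L m (n + 1)) => (1 : 𝔸ˣ)) hL (fun _ => 0) (fun _ => by norm_num)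
              (perCfg_UlevOf_one_mem_U1 L m (n + 1)) (norm_Wcx_UlevOf_one_sub_one_le L m (n + 1) (fun _ => 0) (fun _ => le_rfl)) τ
              (c₀ := c₀) (c₁ := c₁) a) hpos1 y)‖ ≤ C * α * ‖y‖ ∧
          ‖covDivL2K ℂ c₀ ((η : ℂ))⁻¹ (adTransportW φ fun _ : Bond d (towerP L m (n + 1)) => (1 : 𝔸ˣ)⁻¹)
            (B11Eq103H1Complex.greenK (laplaceAk L m n φ η U hL αU hα1 hU1 hreg τ (c₀ := c₀) (c₁ := c₁) a) hposU y -
            B11Eq103H1Complex.greenK (laplaceAk L m n φ η (fun _ : Bond d (towerP L m (n + 1)) => (1 : 𝔸ˣ)) hL (fun _ => 0) (fun _ => by norm_num)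
              (perCfg_UlevOf_one_mem_U1 L m (n + 1)) (norm_Wcx_UlevOf_one_sub_one_le L m (n + 1) (fun _ => 0) (fun _ => le_rfl)) τ
              (c₀ := c₀) (c₁ := c₁) a) hpos1 y)‖ ≤ C * α * ‖y‖ := by
  have hL0 : (0 : ℝ) < L := by exact_mod_cast Nat.pos_of_ne_zero (NeZero.ne L)
  have h1r : 0 < 1 - r := by linarith
  have hd0 : (0 : ℝ) ≤ Real.sqrt d := Real.sqrt_nonneg _
  -- the closed letters of the `R`-letter (K = 2M_φM_φ′; the (3.25) representation at the auxiliary site penalty a′ = 1)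
  obtain ⟨sD, hsDdef⟩ : ∃ sD : ℝ, sD = Real.sqrt d * (2 * Mφ * Mφ') := ⟨_, rfl⟩
  have hsD : 0 ≤ sD := by rw [hsDdef]; positivity
  obtain ⟨cc, hccdef⟩ : ∃ cc : ℝ, cc = ((d * (L - 1) : ℕ) : ℝ) * (2 * Mφ * Mφ') / (1 - r) := ⟨_, rfl⟩
  have hcc : 0 ≤ cc := by rw [hccdef]; positivity
  obtain ⟨sQ, hsQdef⟩ : ∃ sQ : ℝ, sQ = 2 * (((d * (L - 1) : ℕ) : ℝ) * (2 * Mφ * Mφ') / (1 - r)) := ⟨_, rfl⟩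
  have hsQ : 0 ≤ sQ := by rw [hsQdef]; positivity
  obtain ⟨sS, hsSdef⟩ : ∃ sS : ℝ, sS = Real.sqrt (1 / (12 * (d : ℝ) * (6 / 5) ^ (d - 1) + 1) ^ 2) := ⟨_, rfl⟩
  have hsS : 0 < sS := by rw [hsSdef]; positivity
  obtain ⟨Sbar, hSbardef⟩ : ∃ Sbar : ℝ, Sbar = 2 * (48 * sD + 192 * sQ) + 4 * sQ := ⟨_, rfl⟩
  have hSbar : 0 ≤ Sbar := by rw [hSbardef]; positivity
  obtain ⟨CRb, hCRbdef⟩ : ∃ CRb : ℝ, CRb = 3 * Sbar / sS := ⟨_, rfl⟩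
  have hCRb : 0 ≤ CRb := by rw [hCRbdef]; positivity
  -- the OWNER's `∃`, opened ONCE at the fixed `R`-letter constant `C̄_R`
  obtain ⟨α₁, C, hα₁, hC, H⟩ :=
    B9Eq386GreenkLipschitzEnergyDiagonal.exists_norm_G1k_sub_flat_le_diagonal_closed L hL φ hMφ hMφ' hφ hφ' ha hr0 hr1 τ hτ hCτ hρw hCRb
  -- the two windows of the `R`-letter and the window `2s_Aα₀ ≤ s♯`
  obtain ⟨α₂, hα₂def⟩ : ∃ α₂ : ℝ, α₂ = min (1 / (cc + sQ + sD + 1)) (1 / (16 * sD + 24 * sQ + 1)) := ⟨_, rfl⟩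
  have hα₂0 : 0 < α₂ := by rw [hα₂def]; exact lt_min (by positivity) (by positivity)
  refine ⟨min α₁ (min α₂ (sS / (2 * Sbar + 1))), C, lt_min hα₁ (lt_min hα₂0 (by positivity)), hC, ?_⟩
  intro n η hηL c₀ c₁ _ _ hw hρ m _ U αU hα1 hU1 hreg εU hεU hUε α hα0 hαle hRS hUb hUη hpl hεg hposU hpos1 y
  -- name the final threshold (opaque)
  obtain ⟨α₀, hα₀def⟩ : ∃ α₀ : ℝ, α₀ = min α₁ (min α₂ (sS / (2 * Sbar + 1))) := ⟨_, rfl⟩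
  rw [← hα₀def] at hαle
  have hα₀0 : 0 < α₀ := by rw [hα₀def]; exact lt_min hα₁ (lt_min hα₂0 (by positivity))
  have hα₀1 : α₀ ≤ α₁ := by rw [hα₀def]; exact min_le_left _ _
  have hα₀2 : α₀ ≤ α₂ := by rw [hα₀def]; exact (min_le_right _ _).trans (min_le_left _ _)
  have hα₀S : α₀ ≤ sS / (2 * Sbar + 1) := by rw [hα₀def]; exact (min_le_right _ _).trans (min_le_right _ _)
  have hα₂a : α₂ ≤ 1 / (cc + sQ + sD + 1) := by rw [hα₂def]; exact min_le_left _ _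
  have hα₂b : α₂ ≤ 1 / (16 * sD + 24 * sQ + 1) := by rw [hα₂def]; exact min_le_right _ _
  -- stage 1: the windows at α₀
  have pQ : 0 ≤ sQ * α₀ := mul_nonneg hsQ hα₀0.le
  have pD : 0 ≤ sD * α₀ := mul_nonneg hsD hα₀0.le
  have pc : 0 ≤ cc * α₀ := mul_nonneg hcc hα₀0.le
  have hA : α₀ * (cc + sQ + sD + 1) ≤ 1 := by
    have h := mul_le_mul_of_nonneg_right (hα₀2.trans hα₂a) (by positivity : 0 ≤ cc + sQ + sD + 1)
    rwa [one_div, inv_mul_cancel₀ (by positivity : cc + sQ + sD + 1 ≠ 0)] at h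
  have eA : α₀ * (cc + sQ + sD + 1) = cc * α₀ + sQ * α₀ + sD * α₀ + α₀ := by ring
  rw [eA] at hA
  have hc1 : cc * α₀ ≤ 1 := by linarith
  have hθb1 : sQ * α₀ ≤ 1 := by linarith
  have hB : α₀ * (16 * sD + 24 * sQ + 1) ≤ 1 := by
    have h := mul_le_mul_of_nonneg_right (hα₀2.trans hα₂b) (by positivity : 0 ≤ 16 * sD + 24 * sQ + 1)
    rwa [one_div, inv_mul_cancel₀ (by positivity : 16 * sD + 24 * sQ + 1 ≠ 0)] at h
  have eB : α₀ * (16 * sD + 24 * sQ + 1) = 16 * (sD * α₀) + 24 * (sQ * α₀) + α₀ := by ring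
  rw [eB] at hB
  have h3 : 2 * (sD * α₀) + 3 * (sQ * α₀) ≤ 1 / 8 := by linarith
  -- the letters at α₀ (a′ = 1), opaque names with definitional equalities
  obtain ⟨θb, hθbdef⟩ : ∃ θb : ℝ, θb = sQ * α₀ := ⟨_, rfl⟩
  obtain ⟨γm, hγmdef⟩ : ∃ γm : ℝ, γm = 1 / (2 + 2 / (1 : ℝ)) - (sD * α₀ + (sD * α₀) ^ 2 + (1 : ℝ) * θb * (2 * 1 + θb)) := ⟨_, rfl⟩
  obtain ⟨sG, hsGdef⟩ : ∃ sG : ℝ, sG = 2 * sD * (γm⁻¹ * (Real.sqrt γm)⁻¹) + (|(1 : ℝ)| * sQ * ((1 + θb) + 1)) * γm⁻¹ ^ 2 := ⟨_, rfl⟩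
  obtain ⟨sA, hsAdef⟩ : ∃ sA : ℝ, sA = sG * (1 + θb) + (2 + 2 / (1 : ℝ)) * sQ := ⟨_, rfl⟩
  have hθb0 : 0 ≤ θb := by rw [hθbdef]; exact pQ
  have hθble : θb ≤ 1 := by rw [hθbdef]; exact hθb1
  have hγm : 1 / 8 ≤ γm := gamma_m_ge hsD hsQ hα₀0.le h3 hθbdef hγmdef
  have hγm0 : 0 < γm := lt_of_lt_of_le (by norm_num) hγm
  -- stage 2: s_A ≤ S̄, hence the window `2s_Aα₀ ≤ s♯` and `3s_A∕s♯ ≤ C̄_R`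
  have hsAle : sA ≤ Sbar := by rw [hSbardef]; exact sA_le_bar hsD hsQ hθb0 hθble hγm hsGdef hsAdef
  have hsG0 : 0 ≤ sG := by rw [hsGdef]; positivity
  have hsA0 : 0 ≤ sA := by rw [hsAdef]; positivity
  have hwin : 2 * sA * α₀ ≤ sS := by
    have h1 : 2 * sA * α₀ ≤ 2 * Sbar * (sS / (2 * Sbar + 1)) :=
      mul_le_mul (mul_le_mul_of_nonneg_left hsAle (by norm_num)) hα₀S hα₀0.le (by positivity)
    have h2 : 2 * Sbar * (sS / (2 * Sbar + 1)) ≤ sS := by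
      rw [mul_div_assoc', div_le_iff₀ (by positivity)]
      have e : sS * (2 * Sbar + 1) = 2 * Sbar * sS + sS := by ring
      rw [e]; linarith [hsS.le]
    exact h1.trans h2
  have hCRle : 3 * sA / sS ≤ CRb := by
    rw [hCRbdef]; exact div_le_div_of_nonneg_right (by linarith) hsS.le
  -- the R-letter BY NAME (a′ = 1, slopes at α₀), then weakened to the fixed constant `C̄_R`
  have hLb := hLb_of_hU1 L m n U hU1
  have hR : ∀ s : SiteL2K ℂ d (towerP L m (n + 1)) c₀ W,
      ‖RofUk L m n φ η U s - RofUk L m n φ η (fun _ : Bond d (towerP L m (n + 1)) => (1 : 𝔸ˣ)) s‖ ≤ CRb * α * ‖s‖ := by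
    intro s
    have h := norm_RofUk_sub_RofUk_one_le_diagonal_linear L m n φ hMφ hMφ' hφ hφ' c₀ η c₁ (one_pos : (0 : ℝ) < 1) hηL hw U hRS hα0 hUb hUη
      εU hεU hUε hLb hr0 hr1 hαle hεg hsDdef hsQdef hθbdef hγmdef hsGdef hsAdef hsSdef (by rw [← hccdef]; exact hc1) hγm0 hwin s
    exact h.trans (mul_le_mul_of_nonneg_right (mul_le_mul_of_nonneg_right hCRle hα0) (norm_nonneg _))
  exact H n η hηL c₀ c₁ hw hρ m U αU hα1 hU1 hreg εU hεU hUε hα0 (hαle.trans hα₀1) hRS hUb hUη hpl hεg hR hposU hpos1 y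

end Exists

end Literature.MathematicalPhysics.QuantumFieldTheory.Balaban1983to89.B9Eq386GreenLipschitzEnergyClosed

end
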